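import Summits.QuantumFields.BalabanUV.T4Continuum.Support.NE7K1LinWalkExpansion
import Literature.MathematicalPhysics.QuantumFieldTheory.Balaban1983to89.B4RandomWalkDelta112

/-!
# NE7K1LinWalkDelta — row NE7 (node U5), candidate route HOM, path H1L, cell K1-lin(s): B4's `δG` CLAUSE (1.11)–(1.12) ∕ COROLLARY 2.3 FOR AN
# ABSTRACT PAIR OF FINITE-RANGE COERCIVE MATRICES — `B4RandomWalkDelta112` CONSUMED BY NAME with its inputs PROVED: two operators whose
# region blocks agree off a label set `T` have walk expansions with the same pieces there, and `|(P⁻¹ − P′⁻¹)(x,y)| ≤ 2·C·(3^ν τ)^{N−1}` when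
# every label path from `x` THROUGH `T` to `y` has `≥ N` steps

Lineage `b2b-balaban-t4-ne7-p2` (CRUX PROVER NE7 #2), generation 71; series (RW) file 22 (operator-norm packaging; the abstract sibling of
file 3 `NE7K1LinWalkExpansion`).  [Balaban1983RegularityDecay] = T. Bałaban, *Regularity and decay of lattice Green's functions*, Commun.
Math. Phys. 89 (1983) 571–597: p. 573 (1.11)–(1.12) *"If Ω ⊂ Ω₀, then for δG_k(Ω,Ω₀,A) = G_k(Ω,A) − G_k(Ω₀,A) we have the inequalities …
with the additional factor exp(−δ₀ dist(supp f, Ω^c) − δ₀ dist(supp f′, Ω^c))"* and p. 579 after (2.22) *"we take the representations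
(2.13) for both propagators. The terms with ω such that □_{ω_i} are interior cubes of Ω are the same in both representations, so they
cancel in the difference … at least one □_{ω_i} intersects the boundary ∂Ω … with 2^{d+1} instead of 2^d and with the restriction
n ≥ M^{−1}"* ⟦inf⟧*"_{x₁∈Ω^c}(dist({x,x′},x₁) + dist(x₁, supp f)) − 3"*.

The tree's `Balaban1983to89.B4RandomWalkDelta112` (B4 cell, gen 8) types these three sentences over an arbitrary normed ring
(`lattice_walk_delta_bound`), with EVERY operator-theoretic input a hypothesis — both series (2.12), the locality of both families of
pieces, the Lemma 2.1-type bounds, the smallness, and the AGREEMENT `a j = a′ j`, `b j = b′ j` of the two expansions' pieces at the labels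
off `T` (its header: «a property of the construction of p. 575, hypothesis here»; «no instance»).  THIS FILE discharges them for an
ABSTRACT pair `P, P′ : Matrix ι ι ℝ` of `σ`-coercive matrices carrying ONE cut-off system `(l_j, r_j, S_j)_{j ∈ J}` (files 1–3):

* §1 **AGREEMENT OF THE PIECES FROM AGREEMENT OF THE BLOCKS**: if `P` and `P′` have the same `S × S` block then `locOp P S = locOp P′ S`
  (`locOp_congr` — B4's cube operator `G_k(□_j)` «does not depend on the domain» for an interior cube), hence `locInv`, and the pieces
  `a = diag(l)·G_S·diag(r)` (`aPiece_congr`) and `b = [diag(l),P]·G_S·diag(r)` (`bPiece_congr`, using the identity rows of `G_S` outside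
  `S`, `locInv_apply_of_not_mem`, and the cut-off compatibility `CutoffOn` of `l` for both operators) COINCIDE — the agreement hypotheses
  `ha ∕ hb` of `lattice_walk_delta_bound` reduced to the entry-level statement `∀ x y ∈ S_j, P x y = P′ x y` for `j ∉ T`.
* §2 **`inv_sub_inv_entry_decay`** — THE `δG` CLAUSE FOR THE ABSTRACT PAIR: under the hypotheses of file 3's `inv_entry_decay` for BOTH
  operators (same cut-off data, same `(Λ, α², β²)`, same `σ`), a label set `T` off which the region blocks agree, and the printed length
  restriction — every label `j` carrying `x`, every `t ∈ T` and every label `k` carrying `y` satisfy `|pos j − pos t|_μ + |pos t − pos k|_μ′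
  ≥ N ≥ 1` for some coordinates `μ, μ′` — one has
  `|(P⁻¹ − P′⁻¹)(x,y)| ≤ 2·m₀·(Λ∕min(σ,1))·τ·3^ν·(3^ν τ)^{N−1}∕(1 − 3^ν τ)`, `τ = √(α²∕min(σ,1) + β²∕min(σ,1)²)` —
  `B4RandomWalkDelta112.lattice_walk_delta_bound` BY NAME with ALL of its 27 hypotheses DISCHARGED from files 1–3 and §1 (the factor `2` is
  the printed *"2^{d+1} instead of 2^d"*).
* §3 the EXPONENTIAL repackaging (B4's printed form (1.12) ∕ (2.30): `3^ν τ ≤ e^{−δ}` ⇒ factor `e^{−δ(N−1)}`), for the difference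
  (`inv_sub_inv_entry_decay_exp`) and, for the record, for file 3's single propagator (`inv_entry_decay_exp`).

HONEST FRAMING: [folklore] finite linear algebra + the tree's B4 bookkeeping; ONE scale; (H-comm), the region geometry and the block
agreement are hypotheses here (file 23 instantiates them at A = 0 for two unions of big blocks `Ω ⊂ Ω₀`); only the operator-norm
(«L²», Corollary 2.3) shape — NOT the Hölder-norm version (1.9) of the clause, NOT the multi-scale factor; nothing of Bałaban's asserted;
no `sorry`.  Census only (cell K1-lin(s)'s «template application», random-walk half: the `δG` clause typed at the abstract level); NO
letter ∕ tag ∕ size of NE7 moves; NE7 NOT PRINTED ∕ NOT PROVED; spine 0∕9; FIXED FINITE T⁴, rung (B)+1; NOT infinite volume, NOT mass gap,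
NOT Clay.  HONEST DEPENDENCY: continuum YM on T⁴ ⇐ BetaPertH ∧ nine spine estimates (0/9 proved); BetaPertH ⇐ (D1) ∧ (D4) ∧ CAP+tail;
G-an2-4 gates asym, D1 and NE2/3/4.
-/

noncomputable section

open Finset Matrix
open scoped Matrix.Norms.L2Operator

namespace Summit.QuantumFields.BalabanUV.T4Continuum.NE7K1LinWalkDelta

open NE7K1LinSchurLineForm NE7K1LinSchurLineDerivRel NE7K1LinInvAntitone NE7K1LinWalkParametrix NE7K1LinWalkSmallness
  NE7K1LinWalkExpansion
open Literature.MathematicalPhysics.QuantumFieldTheory.Balaban1983to89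

variable {ι : Type*} [Fintype ι] [DecidableEq ι]

/-! ### §1 Agreement of the pieces of two operators with the same region block -/

omit [Fintype ι] in
/-- **THE CUBE OPERATOR DOES NOT SEE THE DOMAIN**: if `P` and `P′` have the same `S × S` block, their local operators on `S` coincide
(B4 p. 579: for an interior cube `□_j` of `Ω` the operator `G_k(□_j)` is the same for `Ω` and `Ω₀`). [cite: Balaban1983RegularityDecay, p.579 after (2.22) «the terms … are the same in both representations», mechanism] [folklore] -/
theorem locOp_congr {P P' : Matrix ι ι ℝ} {S : Finset ι} (h : ∀ x ∈ S, ∀ y ∈ S, P x y = P' x y) :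
    locOp P S = locOp P' S := by
  ext x y
  by_cases hx : x ∈ S
  · rw [locOp_apply_of_mem P hx, locOp_apply_of_mem P' hx]
    by_cases hy : y ∈ S
    · rw [if_pos hy, if_pos hy, h x hx y hy]
    · rw [if_neg hy, if_neg hy]
  · rw [locOp_apply_of_not_mem P hx, locOp_apply_of_not_mem P' hx]

/-- hence the local inverses coincide. [folklore] -/
theorem locInv_congr {P P' : Matrix ι ι ℝ} {S : Finset ι} (h : ∀ x ∈ S, ∀ y ∈ S, P x y = P' x y) :
    locInv P S = locInv P' S := by
  rw [locInv, locInv, locOp_congr h]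

/-- **THE `G₀`-PIECES AGREE**: `a_j = diag(l_j)·G_j·diag(r_j)` is the same for `P` and `P′` when their `S_j × S_j` blocks agree —
hypothesis `ha` of `B4RandomWalkDelta112.lattice_walk_delta_bound`. [cite: Balaban1983RegularityDecay, p.579 after (2.22), mechanism] [folklore] -/
theorem aPiece_congr {P P' : Matrix ι ι ℝ} {l r : ι → ℝ} {S : Finset ι} (h : ∀ x ∈ S, ∀ y ∈ S, P x y = P' x y) :
    aPiece P l r S = aPiece P' l r S := by
  rw [aPiece, aPiece, locInv_congr h]

/-- the local inverse has IDENTITY ROWS outside `S`: `G_S(x,y) = [x = y]` for `x ∉ S`. [folklore] -/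
theorem locInv_apply_of_not_mem (P : Matrix ι ι ℝ) {σ : ℝ} (hσ : 0 < σ) (hPc : ∀ w, σ * (w ⬝ᵥ w) ≤ w ⬝ᵥ P *ᵥ w)
    (S : Finset ι) {x : ι} (hx : x ∉ S) (y : ι) : locInv P S x y = if x = y then 1 else 0 := by
  have h := congrFun (congrFun (locOp_mul_locInv P hσ hPc S) x) y
  rw [Matrix.mul_apply, Matrix.one_apply] at h
  simp only [locOp_apply_of_not_mem P hx] at h
  rw [Finset.sum_eq_single x (fun z _ hzx => by simp [hzx]) (fun h' => absurd (Finset.mem_univ x) h')] at h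
  simpa using h

/-- the matrix `G_S·diag(r)` has ZERO ROWS outside `S` when `supp r ⊆ S`. [folklore] -/
theorem locInv_mul_diagonal_apply_of_not_mem (P : Matrix ι ι ℝ) {σ : ℝ} (hσ : 0 < σ)
    (hPc : ∀ w, σ * (w ⬝ᵥ w) ≤ w ⬝ᵥ P *ᵥ w) {r : ι → ℝ} {S : Finset ι} (hr : ∀ x, r x ≠ 0 → x ∈ S) {x : ι}
    (hx : x ∉ S) (y : ι) : (locInv P S * diagonal r) x y = 0 := by
  rw [mul_diagonal, locInv_apply_of_not_mem P hσ hPc S hx]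
  by_cases hxy : x = y
  · subst hxy
    have : r x = 0 := by by_contra h; exact hx (hr x h)
    rw [this, mul_zero]
  · rw [if_neg hxy, zero_mul]

/-- **THE REMAINDER PIECES AGREE**: `b_j = [diag(l_j),P]·G_j·diag(r_j)` is the same for `P` and `P′` when their `S_j × S_j` blocks agree,
`l_j` lives on `S_j` for both operators, `supp r_j ⊆ S_j` and `P′` is coercive (only the columns `y ∈ S_j` of the commutator are used, and there the
commutator entries `(l_x − l_y)P_{xy}` agree: inside `S_j` by the block agreement, outside by the cut-off compatibility) — hypothesis
`hb` of `B4RandomWalkDelta112.lattice_walk_delta_bound`. [cite: Balaban1983RegularityDecay, p.579 after (2.22), mechanism] [folklore] -/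
theorem bPiece_congr {P P' : Matrix ι ι ℝ} {σ' : ℝ} (hσ' : 0 < σ') (hPc' : ∀ w, σ' * (w ⬝ᵥ w) ≤ w ⬝ᵥ P' *ᵥ w)
    {l r : ι → ℝ} {S : Finset ι}
    (hl : CutoffOn P l S) (hl' : CutoffOn P' l S) (hr : ∀ x, r x ≠ 0 → x ∈ S)
    (h : ∀ x ∈ S, ∀ y ∈ S, P x y = P' x y) : bPiece P l r S = bPiece P' l r S := by
  rw [bPiece, bPiece, Matrix.mul_assoc, Matrix.mul_assoc, locInv_congr h]
  ext x z
  rw [Matrix.mul_apply, Matrix.mul_apply]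
  refine Finset.sum_congr rfl fun y _ => ?_
  by_cases hy : y ∈ S
  · congr 1
    by_cases hx : x ∈ S
    · rw [comm_apply, comm_apply, h x hx y hy]
    · rw [comm_apply_eq_zero_of_not_mem hl hx, comm_apply_eq_zero_of_not_mem hl' hx]
  · rw [locInv_mul_diagonal_apply_of_not_mem P' hσ' hPc' hr hy, mul_zero, mul_zero]

/-! ### §2 The `δG` clause for an abstract pair: `B4RandomWalkDelta112.lattice_walk_delta_bound` with every hypothesis discharged -/

/-- **THE `δG` CLAUSE (1.11)–(1.12) ∕ COROLLARY 2.3 FOR AN ABSTRACT PAIR OF FINITE-RANGE COERCIVE MATRICES.**  Data: `P`, `P′` both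
`σ`-coercive on one finite index type; ONE system of cut-off triples `(l_j, r_j, S_j)` indexed by a finite `J` with labels
`pos : J → ℤ^ν` (injective) such that regions with NON-ADJACENT labels are DISJOINT; `l_j` lives on `S_j` for `P` AND for `P′`,
`Σ_j l_j r_j ≡ 1`, `|l_j| ≤ Λ`, `supp r_j ⊆ S_j`, `|r_j| ≤ 1`; (H-comm) with `(α², β²)` for both; at most `m₀` of the `l_j` nonzero at `x`;
`3^ν·τ < 1` (`τ = √(α²∕min(σ,1) + β²∕min(σ,1)²)`) and both remainders of norm `< 1`; a label set `T` such that `P` and `P′` have THE SAME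
`S_j × S_j` BLOCK for every `j ∉ T` (B4: the cubes interior to `Ω`); and the printed length restriction: every label `j` carrying `x`,
every `t ∈ T` and every label `k` carrying `y` have `|pos j − pos t|_μ + |pos t − pos k|_{μ′} ≥ N ≥ 1` for some `μ, μ′`.  Then
`|(P⁻¹ − P′⁻¹)(x,y)| ≤ 2·m₀·(Λ∕min(σ,1))·τ·3^ν·(3^ν τ)^{N−1}∕(1 − 3^ν τ)` — `B4RandomWalkDelta112.lattice_walk_delta_bound` BY NAME, all
hypotheses discharged (the agreement of the pieces off `T` by §1; the rest as in file 3's `inv_entry_decay`, twice).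
[cite: Balaban1983RegularityDecay, (1.11)–(1.12) p.573, p.579 after (2.22) «2^{d+1} instead of 2^d … n ≥ M⁻¹ inf(dist + dist) − 3», Corollary 2.3 p.581] [folklore] -/
theorem inv_sub_inv_entry_decay {J : Type*} [Fintype J] [DecidableEq J] {ν : ℕ} (pos : J → Fin ν → ℤ)
    (hpos : Function.Injective pos) (P P' : Matrix ι ι ℝ) {σ : ℝ} (hσ : 0 < σ)
    (hPc : ∀ w, σ * (w ⬝ᵥ w) ≤ w ⬝ᵥ P *ᵥ w) (hPc' : ∀ w, σ * (w ⬝ᵥ w) ≤ w ⬝ᵥ P' *ᵥ w)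
    (l r : J → ι → ℝ) (S : J → Finset ι)
    (hdisj : ∀ j k, ¬ B4RandomWalk213.cubeAdj pos j k → Disjoint (S j) (S k))
    (hcut : ∀ j, CutoffOn P (l j) (S j)) (hcut' : ∀ j, CutoffOn P' (l j) (S j)) (hpu : ∀ x, ∑ j, l j x * r j x = 1)
    {Λ : ℝ} (hΛ : 0 ≤ Λ) (hl : ∀ j x, |l j x| ≤ Λ) (hr : ∀ j x, r j x ≠ 0 → x ∈ S j) (hr1 : ∀ j x, |r j x| ≤ 1)
    {α2 β2 : ℝ} (hα : 0 ≤ α2) (hβ : 0 ≤ β2)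
    (hcomm : ∀ j v, comm (l j) P *ᵥ v ⬝ᵥ comm (l j) P *ᵥ v ≤ α2 * (v ⬝ᵥ P *ᵥ v) + β2 * (v ⬝ᵥ v))
    (hcomm' : ∀ j v, comm (l j) P' *ᵥ v ⬝ᵥ comm (l j) P' *ᵥ v ≤ α2 * (v ⬝ᵥ P' *ᵥ v) + β2 * (v ⬝ᵥ v))
    (hsmall : (3 : ℝ) ^ ν * Real.sqrt (α2 / min σ 1 + β2 / (min σ 1) ^ 2) < 1)
    (hR : ‖∑ j, bPiece P (l j) (r j) (S j)‖ < 1) (hR' : ‖∑ j, bPiece P' (l j) (r j) (S j)‖ < 1)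
    (T : Finset J) (hagree : ∀ j ∉ T, ∀ x ∈ S j, ∀ y ∈ S j, P x y = P' x y)
    {m₀ : ℕ} (x y : ι) (hm₀ : (univ.filter fun j => l j x ≠ 0).card ≤ m₀) {N : ℕ} (hN : 1 ≤ N)
    (hsepT : ∀ j, l j x ≠ 0 → ∀ t ∈ T, ∀ k, r k y ≠ 0 →
      ∃ μ μ', (N : ℤ) ≤ |pos j μ - pos t μ| + |pos t μ' - pos k μ'|) :
    |(P⁻¹ - P'⁻¹) x y| ≤ 2 * (m₀ * (Λ / min σ 1) * Real.sqrt (α2 / min σ 1 + β2 / (min σ 1) ^ 2) * (3 : ℝ) ^ ν *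
      ((3 : ℝ) ^ ν * Real.sqrt (α2 / min σ 1 + β2 / (min σ 1) ^ 2)) ^ (N - 1) /
        (1 - (3 : ℝ) ^ ν * Real.sqrt (α2 / min σ 1 + β2 / (min σ 1) ^ 2))) := by
  classical
  have hσ' : 0 < min σ 1 := lt_min hσ one_pos
  set τ := Real.sqrt (α2 / min σ 1 + β2 / (min σ 1) ^ 2) with hτ
  have hτ0 : 0 ≤ τ := Real.sqrt_nonneg _
  set a : J → Matrix ι ι ℝ := fun j => aPiece P (l j) (r j) (S j) with ha
  set b : J → Matrix ι ι ℝ := fun j => bPiece P (l j) (r j) (S j) with hb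
  set a' : J → Matrix ι ι ℝ := fun j => aPiece P' (l j) (r j) (S j) with ha'
  set b' : J → Matrix ι ι ℝ := fun j => bPiece P' (l j) (r j) (S j) with hb'
  set S₀ : Finset J := univ.filter fun j => l j x ≠ 0 with hS₀
  set S₁ : Finset J := univ.filter fun j => r j y ≠ 0 with hS₁
  -- the two series (2.12)
  have hG : HasSum (fun n : ℕ => (∑ j, a j) * (∑ j, b j) ^ n) P⁻¹ := hasSum_walk_expansion P hσ hPc l r S hcut hpu hR
  have hG' : HasSum (fun n : ℕ => (∑ j, a' j) * (∑ j, b' j) ^ n) P'⁻¹ :=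
    hasSum_walk_expansion P' hσ hPc' l r S hcut' hpu hR'
  -- locality of both families
  have hab : ∀ i k, ¬ B4RandomWalk213.cubeAdj pos i k → a i * b k = 0 := fun i k hik =>
    aPiece_mul_bPiece P (hr i) (hcut k) (hdisj i k hik)
  have hbb : ∀ i k, ¬ B4RandomWalk213.cubeAdj pos i k → b i * b k = 0 := fun i k hik =>
    bPiece_mul_bPiece P (hr i) (hcut k) (hdisj i k hik)
  have hab' : ∀ i k, ¬ B4RandomWalk213.cubeAdj pos i k → a' i * b' k = 0 := fun i k hik =>
    aPiece_mul_bPiece P' (hr i) (hcut' k) (hdisj i k hik)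
  have hbb' : ∀ i k, ¬ B4RandomWalk213.cubeAdj pos i k → b' i * b' k = 0 := fun i k hik =>
    bPiece_mul_bPiece P' (hr i) (hcut' k) (hdisj i k hik)
  -- AGREEMENT of the pieces off `T` (§1)
  have hag : ∀ i ∉ T, a i = a' i := fun i hi => aPiece_congr (hagree i hi)
  have hbg : ∀ i ∉ T, b i = b' i := fun i hi =>
    bPiece_congr hσ hPc' (hcut i) (hcut' i) (hr i) (hagree i hi)
  -- support cut-offs
  have hlA : ∀ i ∉ S₀, ∀ z, z ∈ ({x} : Finset ι) → l i z = 0 := fun i hi z hz => by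
    rw [Finset.mem_singleton] at hz; subst hz
    by_contra h; exact hi (Finset.mem_filter.mpr ⟨Finset.mem_univ _, h⟩)
  have hrB : ∀ i ∉ S₁, ∀ z, z ∈ ({y} : Finset ι) → r i z = 0 := fun i hi z hz => by
    rw [Finset.mem_singleton] at hz; subst hz
    by_contra h; exact hi (Finset.mem_filter.mpr ⟨Finset.mem_univ _, h⟩)
  have hPcut : ∀ i ∉ S₀, ind {x} * a i = 0 := fun i hi =>
    (piece_cutoffs P (A := {x}) (B := ∅) (hlA i hi) (fun z hz => absurd hz (Finset.notMem_empty z))).1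
  have hPcut' : ∀ i ∉ S₀, ind {x} * a' i = 0 := fun i hi =>
    (piece_cutoffs P' (A := {x}) (B := ∅) (hlA i hi) (fun z hz => absurd hz (Finset.notMem_empty z))).1
  have hP'a : ∀ i ∉ S₁, a i * ind {y} = 0 := fun i hi =>
    (piece_cutoffs P (A := ∅) (fun z hz => absurd hz (Finset.notMem_empty z)) (hrB i hi)).2.1
  have hP'b : ∀ i ∉ S₁, b i * ind {y} = 0 := fun i hi =>
    (piece_cutoffs P (A := ∅) (fun z hz => absurd hz (Finset.notMem_empty z)) (hrB i hi)).2.2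
  have hP'a' : ∀ i ∉ S₁, a' i * ind {y} = 0 := fun i hi =>
    (piece_cutoffs P' (A := ∅) (fun z hz => absurd hz (Finset.notMem_empty z)) (hrB i hi)).2.1
  have hP'b' : ∀ i ∉ S₁, b' i * ind {y} = 0 := fun i hi =>
    (piece_cutoffs P' (A := ∅) (fun z hz => absurd hz (Finset.notMem_empty z)) (hrB i hi)).2.2
  -- the Lemma 2.1-type bounds, for both families
  have hind1 : ∀ z : ι, ‖ind ({z} : Finset ι)‖ ≤ 1 := fun z => l2_opNorm_ind_le_one {z}
  have hαw : ∀ i, ‖ind {x} * a i‖ ≤ Λ / min σ 1 := fun i =>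
    (Matrix.l2_opNorm_mul _ _).trans <| by
      have h1 := hind1 x
      have h2 := l2_opNorm_aPiece_le P hσ hPc hΛ (hl i) (hr1 i) (S i)
      have h3 : 0 ≤ ‖a i‖ := norm_nonneg _
      nlinarith
  have hαw' : ∀ i, ‖ind {x} * a' i‖ ≤ Λ / min σ 1 := fun i =>
    (Matrix.l2_opNorm_mul _ _).trans <| by
      have h1 := hind1 x
      have h2 := l2_opNorm_aPiece_le P' hσ hPc' hΛ (hl i) (hr1 i) (S i)
      have h3 : 0 ≤ ‖a' i‖ := norm_nonneg _
      nlinarith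
  have hβw : ∀ i, ‖b i‖ ≤ τ := fun i => l2_opNorm_bPiece_le P hσ hPc (hr i) (hr1 i) hα hβ (hcomm i)
  have hβw' : ∀ i, ‖b' i‖ ≤ τ := fun i => l2_opNorm_bPiece_le P' hσ hPc' (hr i) (hr1 i) hα hβ (hcomm' i)
  have hβ₁ : ∀ i, ‖b i * ind {y}‖ ≤ τ := fun i =>
    (Matrix.l2_opNorm_mul _ _).trans <| by
      have h1 := hind1 y
      have h2 := hβw i
      have h3 : 0 ≤ ‖ind ({y} : Finset ι)‖ := norm_nonneg _
      nlinarith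
  have hβ₁' : ∀ i, ‖b' i * ind {y}‖ ≤ τ := fun i =>
    (Matrix.l2_opNorm_mul _ _).trans <| by
      have h1 := hind1 y
      have h2 := hβw' i
      have h3 : 0 ≤ ‖ind ({y} : Finset ι)‖ := norm_nonneg _
      nlinarith
  -- the length restriction through `T`
  have hsep' : ∀ i ∈ S₀, ∀ t ∈ T, ∀ k ∈ S₁, ∃ μ μ', (N : ℤ) ≤ |pos i μ - pos t μ| + |pos t μ' - pos k μ'| :=
    fun i hi t ht k hk => hsepT i (Finset.mem_filter.mp hi).2 t ht k (Finset.mem_filter.mp hk).2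
  have hmain := B4RandomWalkDelta112.lattice_walk_delta_bound pos hpos (a := a) (b := b) (a' := a') (b' := b')
    (G := P⁻¹) (G' := P'⁻¹) rfl rfl rfl rfl hG hG' hab hbb hab' hbb' hag hbg hPcut hPcut' hP'a hP'b hP'a' hP'b'
    hαw hαw' hτ0 hβw hβw' hβ₁ hβ₁' hsmall hN hsep'
  -- read off the entry
  have hent : |(P⁻¹ - P'⁻¹) x y| ≤ ‖ind {x} * (P⁻¹ - P'⁻¹) * ind {y}‖ := by
    rw [← ind_mul_mul_ind_apply (P⁻¹ - P'⁻¹) x y]; exact abs_entry_le_l2_opNorm _ x y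
  refine hent.trans (hmain.trans ?_)
  have hden : 0 < 1 - (3 : ℝ) ^ ν * τ := by linarith
  have hnum : 0 ≤ Λ / min σ 1 * τ * (3 : ℝ) ^ ν * ((3 : ℝ) ^ ν * τ) ^ (N - 1) := by positivity
  have hcard : (S₀.card : ℝ) ≤ m₀ := by exact_mod_cast hm₀
  refine mul_le_mul_of_nonneg_left ?_ (by norm_num)
  rw [div_le_div_iff_of_pos_right hden]
  calc (S₀.card : ℝ) * (Λ / min σ 1) * τ * (3 : ℝ) ^ ν * ((3 : ℝ) ^ ν * τ) ^ (N - 1)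
      = S₀.card * (Λ / min σ 1 * τ * (3 : ℝ) ^ ν * ((3 : ℝ) ^ ν * τ) ^ (N - 1)) := by ring
    _ ≤ m₀ * (Λ / min σ 1 * τ * (3 : ℝ) ^ ν * ((3 : ℝ) ^ ν * τ) ^ (N - 1)) := mul_le_mul_of_nonneg_right hcard hnum
    _ = m₀ * (Λ / min σ 1) * τ * (3 : ℝ) ^ ν * ((3 : ℝ) ^ ν * τ) ^ (N - 1) := by ring

/-! ### §3 The exponential form (the printed factor `e^{−δ(N−1)}` of (1.12) ∕ (2.30)) -/

omit [Fintype ι] [DecidableEq ι] in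
/-- geometric ⇒ exponential: `q ≤ e^{−δ}` (`q ≥ 0`, `δ > 0`) ⇒ `C·q^{N−1}∕(1 − q) ≤ C∕(1 − e^{−δ})·e^{−δ(N−1)}` for `C ≥ 0`. [folklore] -/
theorem geom_le_exp {C q δ : ℝ} (hC : 0 ≤ C) (hq : 0 ≤ q) (hδ : 0 < δ) (hqδ : q ≤ Real.exp (-δ)) (N : ℕ) :
    C * q ^ (N - 1) / (1 - q) ≤ C / (1 - Real.exp (-δ)) * Real.exp (-(δ * ((N - 1 : ℕ) : ℝ))) := by
  have he1 : Real.exp (-δ) < 1 := Real.exp_lt_one_iff.mpr (neg_lt_zero.mpr hδ)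
  have hq1 : q < 1 := hqδ.trans_lt he1
  have hpow : q ^ (N - 1) ≤ Real.exp (-(δ * ((N - 1 : ℕ) : ℝ))) := by
    rw [show -(δ * ((N - 1 : ℕ) : ℝ)) = ((N - 1 : ℕ) : ℝ) * (-δ) by ring, Real.exp_nat_mul]
    exact pow_le_pow_left₀ hq hqδ _
  have hinv : (1 - q)⁻¹ ≤ (1 - Real.exp (-δ))⁻¹ := inv_anti₀ (by linarith) (by linarith)
  calc C * q ^ (N - 1) / (1 - q) = C * (1 - q)⁻¹ * q ^ (N - 1) := by rw [div_eq_mul_inv]; ring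
    _ ≤ C * (1 - Real.exp (-δ))⁻¹ * Real.exp (-(δ * ((N - 1 : ℕ) : ℝ))) :=
        mul_le_mul (mul_le_mul_of_nonneg_left hinv hC) hpow (pow_nonneg hq _)
          (mul_nonneg hC (inv_nonneg.mpr (by linarith)))
    _ = C / (1 - Real.exp (-δ)) * Real.exp (-(δ * ((N - 1 : ℕ) : ℝ))) := by rw [div_eq_mul_inv]

/-- **THE `δG` CLAUSE IN EXPONENTIAL FORM**: under the hypotheses of `inv_sub_inv_entry_decay` and `3^ν τ ≤ e^{−δ}` (`δ > 0`),
`|(P⁻¹ − P′⁻¹)(x,y)| ≤ 2·m₀·(Λ∕min(σ,1))·τ·3^ν∕(1 − e^{−δ}) · e^{−δ(N−1)}` — the printed *"additional factor"* of (1.12) ∕ Corollary 2.3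
in the number `N − 1` of forced extra steps through `T`. [cite: Balaban1983RegularityDecay, (1.12) p.573, Corollary 2.3 (2.30) pp.580–581] [folklore] -/
theorem inv_sub_inv_entry_decay_exp {J : Type*} [Fintype J] [DecidableEq J] {ν : ℕ} (pos : J → Fin ν → ℤ)
    (hpos : Function.Injective pos) (P P' : Matrix ι ι ℝ) {σ : ℝ} (hσ : 0 < σ)
    (hPc : ∀ w, σ * (w ⬝ᵥ w) ≤ w ⬝ᵥ P *ᵥ w) (hPc' : ∀ w, σ * (w ⬝ᵥ w) ≤ w ⬝ᵥ P' *ᵥ w)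
    (l r : J → ι → ℝ) (S : J → Finset ι)
    (hdisj : ∀ j k, ¬ B4RandomWalk213.cubeAdj pos j k → Disjoint (S j) (S k))
    (hcut : ∀ j, CutoffOn P (l j) (S j)) (hcut' : ∀ j, CutoffOn P' (l j) (S j)) (hpu : ∀ x, ∑ j, l j x * r j x = 1)
    {Λ : ℝ} (hΛ : 0 ≤ Λ) (hl : ∀ j x, |l j x| ≤ Λ) (hr : ∀ j x, r j x ≠ 0 → x ∈ S j) (hr1 : ∀ j x, |r j x| ≤ 1)
    {α2 β2 : ℝ} (hα : 0 ≤ α2) (hβ : 0 ≤ β2)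
    (hcomm : ∀ j v, comm (l j) P *ᵥ v ⬝ᵥ comm (l j) P *ᵥ v ≤ α2 * (v ⬝ᵥ P *ᵥ v) + β2 * (v ⬝ᵥ v))
    (hcomm' : ∀ j v, comm (l j) P' *ᵥ v ⬝ᵥ comm (l j) P' *ᵥ v ≤ α2 * (v ⬝ᵥ P' *ᵥ v) + β2 * (v ⬝ᵥ v))
    {δ : ℝ} (hδ : 0 < δ) (hsmall : (3 : ℝ) ^ ν * Real.sqrt (α2 / min σ 1 + β2 / (min σ 1) ^ 2) ≤ Real.exp (-δ))
    (hR : ‖∑ j, bPiece P (l j) (r j) (S j)‖ < 1) (hR' : ‖∑ j, bPiece P' (l j) (r j) (S j)‖ < 1)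
    (T : Finset J) (hagree : ∀ j ∉ T, ∀ x ∈ S j, ∀ y ∈ S j, P x y = P' x y)
    {m₀ : ℕ} (x y : ι) (hm₀ : (univ.filter fun j => l j x ≠ 0).card ≤ m₀) {N : ℕ} (hN : 1 ≤ N)
    (hsepT : ∀ j, l j x ≠ 0 → ∀ t ∈ T, ∀ k, r k y ≠ 0 →
      ∃ μ μ', (N : ℤ) ≤ |pos j μ - pos t μ| + |pos t μ' - pos k μ'|) :
    |(P⁻¹ - P'⁻¹) x y| ≤ 2 * (m₀ * (Λ / min σ 1) * Real.sqrt (α2 / min σ 1 + β2 / (min σ 1) ^ 2) * (3 : ℝ) ^ ν /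
      (1 - Real.exp (-δ)) * Real.exp (-(δ * ((N - 1 : ℕ) : ℝ)))) := by
  have hσ' : 0 < min σ 1 := lt_min hσ one_pos
  have he1 : Real.exp (-δ) < 1 := Real.exp_lt_one_iff.mpr (neg_lt_zero.mpr hδ)
  have h := inv_sub_inv_entry_decay pos hpos P P' hσ hPc hPc' l r S hdisj hcut hcut' hpu hΛ hl hr hr1 hα hβ hcomm hcomm'
    (hsmall.trans_lt he1) hR hR' T hagree x y hm₀ hN hsepT
  refine h.trans (mul_le_mul_of_nonneg_left ?_ (by norm_num))
  exact geom_le_exp (by positivity) (by positivity) hδ hsmall N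

/-- for the record, the same repackaging of file 3's single-propagator decay `NE7K1LinWalkExpansion.inv_entry_decay`: under
`3^ν τ ≤ e^{−δ}` (`δ > 0`), `|P⁻¹(x,y)| ≤ m₀·(Λ∕min(σ,1))·τ·3^ν∕(1 − e^{−δ}) · e^{−δ(N−1)}` — the printed exponential form of (2.22) ∕ (2.30)
`c₀e^{−δ₀dist}` in the number of cube steps. [cite: Balaban1983RegularityDecay, (2.22) p.579, Corollary 2.3 (2.30) pp.580–581] [folklore] -/
theorem inv_entry_decay_exp {J : Type*} [Fintype J] [DecidableEq J] {ν : ℕ} (pos : J → Fin ν → ℤ)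
    (hpos : Function.Injective pos) (P : Matrix ι ι ℝ) {σ : ℝ} (hσ : 0 < σ)
    (hPc : ∀ w, σ * (w ⬝ᵥ w) ≤ w ⬝ᵥ P *ᵥ w) (l r : J → ι → ℝ) (S : J → Finset ι)
    (hdisj : ∀ j k, ¬ B4RandomWalk213.cubeAdj pos j k → Disjoint (S j) (S k))
    (hcut : ∀ j, CutoffOn P (l j) (S j)) (hpu : ∀ x, ∑ j, l j x * r j x = 1)
    {Λ : ℝ} (hΛ : 0 ≤ Λ) (hl : ∀ j x, |l j x| ≤ Λ) (hr : ∀ j x, r j x ≠ 0 → x ∈ S j) (hr1 : ∀ j x, |r j x| ≤ 1)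
    {α2 β2 : ℝ} (hα : 0 ≤ α2) (hβ : 0 ≤ β2)
    (hcomm : ∀ j v, comm (l j) P *ᵥ v ⬝ᵥ comm (l j) P *ᵥ v ≤ α2 * (v ⬝ᵥ P *ᵥ v) + β2 * (v ⬝ᵥ v))
    {δ : ℝ} (hδ : 0 < δ) (hsmall : (3 : ℝ) ^ ν * Real.sqrt (α2 / min σ 1 + β2 / (min σ 1) ^ 2) ≤ Real.exp (-δ))
    (hR : ‖∑ j, bPiece P (l j) (r j) (S j)‖ < 1)
    {m₀ : ℕ} (x y : ι) (hm₀ : (univ.filter fun j => l j x ≠ 0).card ≤ m₀) {N : ℕ} (hN : 1 ≤ N)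
    (hsep : ∀ j, l j x ≠ 0 → ∀ k, r k y ≠ 0 → ∃ μ, (N : ℤ) ≤ |pos j μ - pos k μ|) :
    |P⁻¹ x y| ≤ m₀ * (Λ / min σ 1) * Real.sqrt (α2 / min σ 1 + β2 / (min σ 1) ^ 2) * (3 : ℝ) ^ ν /
      (1 - Real.exp (-δ)) * Real.exp (-(δ * ((N - 1 : ℕ) : ℝ))) := by
  have hσ' : 0 < min σ 1 := lt_min hσ one_pos
  have he1 : Real.exp (-δ) < 1 := Real.exp_lt_one_iff.mpr (neg_lt_zero.mpr hδ)
  have h := inv_entry_decay pos hpos P hσ hPc l r S hdisj hcut hpu hΛ hl hr hr1 hα hβ hcomm (hsmall.trans_lt he1) hR x y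
    hm₀ hN hsep
  exact h.trans (geom_le_exp (by positivity) (by positivity) hδ hsmall N)

end Summit.QuantumFields.BalabanUV.T4Continuum.NE7K1LinWalkDelta

end
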